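import Summits.ResolutionOfSingularities.ResolutionOfSingularities.Theorems.FrobeniusLadderFInjectiveMacaulayficationCNCylinderPrelims
import Mathlib.RingTheory.MvPolynomial.Ideal
import Mathlib.AlgebraicGeometry.Scheme
import HarnessLib

/-!
# CN data × 𝔸¹ — the AXIS of the cylinder is a point: `(x̄₁,…,x̄_n)` is prime in `k[X_{n+1}]/(rename succ f)` when `f` has no
# constant term (crux `FInjectiveMacaulayfication` stmt-ResolutionOfSingularities-15315, chain w45a, hole #3, (iv) Q6-LINE)

Support file for crux stmt-ResolutionOfSingularities-15315 (`FrobeniusLadder.FInjectiveMacaulayfication`), chain w45a, seat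
res-D-pv-017 AS res-L1-w45a-stub-5. [OURS · L1 W4.5a] — NOT a statement of any manuscript; AI-written, weaker than expert review.

`strongPlusStep_cylinder_of_cnData` (`…CNCylinder.lean`) produces the STRONG⁺ step at any point `η` of `Spec k[X_{n+1}]/(f′)`,
`f′ = rename Fin.succ f`, with `η.asIdeal = (x̄₁,…,x̄_n)`. This file shows such an `η` EXISTS (so the calibration is not vacuous): the
substitution `X 0 ↦ T, X (succ j) ↦ 0`, i.e. `Polynomial.mapRingHom constantCoeff ∘ finSuccEquiv : k[X_{n+1}] → k[T]`, has kernel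
`(X₁,…,X_n)` (`ker_axisMap`), kills `f′` when `constantCoeff f = 0`, and so induces `k[X_{n+1}]/(f′) → k[T]` with kernel `(x̄₁,…,x̄_n)`,
which is therefore prime (`isPrime_axis`); `exists_axisPoint` packages the point. No definitions, no named facts. [folklore]
-/

-- single-problem summit: the doubled namespace component is forced
set_option linter.dupNamespace false

noncomputable section

open MvPolynomial

namespace Summit.ResolutionOfSingularities.ResolutionOfSingularities.Theorems.FInjectiveMacaulayfication.CNCylinder

/-- The kernel of `constantCoeff` on `k[X_σ]` is the ideal of the variables. [folklore] -/
theorem ker_constantCoeff_eq_span_X {k : Type} [Field k] {σ : Type} :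
    RingHom.ker (constantCoeff : MvPolynomial σ k →+* k) = Ideal.span (Set.range (X : σ → MvPolynomial σ k)) := by
  classical
  ext x
  rw [RingHom.mem_ker, ← Set.image_univ, mem_ideal_span_X_image, constantCoeff_eq, ← notMem_support_iff]
  constructor
  · intro h0 m hm
    have hm0 : m ≠ 0 := fun h => h0 (h ▸ hm)
    obtain ⟨i, hi⟩ := Finsupp.ne_iff.mp hm0
    exact ⟨i, Set.mem_univ i, hi⟩
  · intro h h0
    obtain ⟨i, -, hi⟩ := h 0 h0
    exact hi rfl

/-- **The kernel of the axis map `X 0 ↦ T, X (succ j) ↦ 0` is `(X₁,…,X_n)`.** [folklore] -/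
theorem ker_axisMap {k : Type} [Field k] {n : ℕ} :
    RingHom.ker ((Polynomial.mapRingHom (constantCoeff : MvPolynomial (Fin n) k →+* k)).comp
        (finSuccEquiv k n).toRingEquiv.toRingHom) =
      Ideal.span (Set.range fun j : Fin n => (X j.succ : MvPolynomial (Fin (n + 1)) k)) := by
  have hsymm : ∀ j : Fin n, (finSuccEquiv k n).symm (Polynomial.C (X j)) = (X j.succ : MvPolynomial (Fin (n + 1)) k) :=
    fun j => by rw [← finSuccEquiv_X_succ, AlgEquiv.symm_apply_apply]
  apply le_antisymm
  · intro x hx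
    rw [RingHom.mem_ker, RingHom.comp_apply] at hx
    have h1 : (finSuccEquiv k n).toRingEquiv.toRingHom x ∈
        (Ideal.span (Set.range (X : Fin n → MvPolynomial (Fin n) k))).map (Polynomial.C : MvPolynomial (Fin n) k →+* Polynomial (MvPolynomial (Fin n) k)) := by
      rw [← ker_constantCoeff_eq_span_X, ← Polynomial.ker_mapRingHom, RingHom.mem_ker]
      exact hx
    have h2 := Ideal.mem_map_of_mem ((finSuccEquiv k n).symm.toRingEquiv.toRingHom) h1
    rw [Ideal.map_map, Ideal.map_span] at h2
    have hx' : (finSuccEquiv k n).symm.toRingEquiv.toRingHom ((finSuccEquiv k n).toRingEquiv.toRingHom x) = x :=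
      (finSuccEquiv k n).symm_apply_apply x
    rw [hx'] at h2
    refine (Ideal.span_mono ?_) h2
    rintro _ ⟨_, ⟨j, rfl⟩, rfl⟩
    exact ⟨j, (hsymm j).symm⟩
  · rw [Ideal.span_le]
    rintro _ ⟨j, rfl⟩
    rw [SetLike.mem_coe, RingHom.mem_ker, RingHom.comp_apply]
    show Polynomial.mapRingHom constantCoeff (finSuccEquiv k n (X j.succ)) = 0
    rw [finSuccEquiv_X_succ, Polynomial.coe_mapRingHom, Polynomial.map_C, constantCoeff_X, map_zero]

/-- **`(x̄₁,…,x̄_n)` is prime in `k[X_{n+1}]/(rename succ f)` when `constantCoeff f = 0`** (the axis of the cylinder over `V(f)` through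
the origin is irreducible, with coordinate ring `k[T]`). [folklore] -/
theorem isPrime_axis {k : Type} [Field k] {n : ℕ} (f : MvPolynomial (Fin n) k) (hf0 : constantCoeff f = 0) :
    (Ideal.span (Set.range fun j : Fin n =>
      Ideal.Quotient.mk (Ideal.span {rename Fin.succ f}) (X j.succ : MvPolynomial (Fin (n + 1)) k))).IsPrime := by
  set ψ : MvPolynomial (Fin (n + 1)) k →+* Polynomial k :=
    (Polynomial.mapRingHom (constantCoeff : MvPolynomial (Fin n) k →+* k)).comp (finSuccEquiv k n).toRingEquiv.toRingHom with hψ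
  have hfψ : Ideal.span {rename Fin.succ f} ≤ RingHom.ker ψ := by
    rw [Ideal.span_le, Set.singleton_subset_iff, SetLike.mem_coe, RingHom.mem_ker, hψ, RingHom.comp_apply]
    show Polynomial.mapRingHom constantCoeff (finSuccEquiv k n (rename Fin.succ f)) = 0
    rw [finSuccEquiv_rename_succ, Polynomial.coe_mapRingHom, Polynomial.map_C, hf0, map_zero]
  have hker : RingHom.ker (Ideal.Quotient.lift (Ideal.span {rename Fin.succ f}) ψ fun a ha => hfψ ha) =
      Ideal.span (Set.range fun j : Fin n =>
        Ideal.Quotient.mk (Ideal.span {rename Fin.succ f}) (X j.succ : MvPolynomial (Fin (n + 1)) k)) := by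
    rw [Ideal.ker_quotient_lift, hψ, ker_axisMap, Ideal.map_span, ← Set.range_comp]
    rfl
  rw [← hker]
  exact RingHom.ker_isPrime _

/-- The generic point of the axis exists: a point `η` of `Spec k[X_{n+1}]/(rename succ f)` with `η.asIdeal = (x̄₁,…,x̄_n)`. [folklore] -/
theorem exists_axisPoint {k : Type} [Field k] {n : ℕ} (f : MvPolynomial (Fin n) k) (hf0 : constantCoeff f = 0) :
    ∃ η : ↥(AlgebraicGeometry.Spec (.of (MvPolynomial (Fin (n + 1)) k ⧸ Ideal.span {rename Fin.succ f}))),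
      η.asIdeal = Ideal.span (Set.range fun j : Fin n =>
        Ideal.Quotient.mk (Ideal.span {rename Fin.succ f}) (X j.succ : MvPolynomial (Fin (n + 1)) k)) :=
  ⟨⟨_, isPrime_axis f hf0⟩, rfl⟩

end Summit.ResolutionOfSingularities.ResolutionOfSingularities.Theorems.FInjectiveMacaulayfication.CNCylinder

end
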